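import Summits.BirchSwinnertonDyer.Rank1Residual.Additive.StrictSignedDualFiniteTorsion
import Summits.BirchSwinnertonDyer.Rank1Residual.Additive.StrictSignedPreimageKummerBound
import Summits.BirchSwinnertonDyer.Rank1Residual.Additive.StrictSignedPreimageFiniteOfExponent
import HarnessLib

/-!
# `X^{−,str}(W/ℚ_∞)` IS `Λ`-TORSION WITH `f(0) ≠ 0` IN RANK ONE, MODULO ONE POITOU–TATE-TYPE
# STATEMENT: the assembly of files 110, 112, 113 (cell `b2b-bsdres`, CLASS-CLOSURE lane, class O10 —
# x1b GEN 43, class lead; file 114 of the series)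

HONEST FRAMING (cell `b2b-bsdres`, run/shared/lean/b2b/bsd-rank1-residual/, verbatim in every
file): the goal of the cell is to DELETE the COMBINATION-SHAPED residual classes of the
Birch–Swinnerton-Dyer formula for ALL analytic-rank `≤ 1` elliptic curves over `ℚ` — "full BSD
formula for every rank `≤ 1` curve in class `C`" assembled STRICTLY from published theorems — so
that the rank-`≤ 1` remainder becomes exactly the CONSTRUCTION-SHAPED classes, which are TYPED
(missing-input `Prop`s), NOT attempted. This is not "finishing BSD". CLASS-CLOSURE lane: prove
what is provable now; shrink each hard class to its core with data; no claim beyond stated classes;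
research routes on CONSTRUCTION-SHAPED X12 / O10; census / instrument output = EVIDENCE / conjecture
items, NEVER a Literature fact; `RESIDUAL-MAP.md` marks change only by signed lines. THIS FILE:
TOOL THEOREMS ONLY — no definition, no named Literature fact, no Summits-side fact `def … : Prop`,
no `sorry`, axioms standard; CONDITIONAL on ONE explicitly displayed hypothesis `hMW` of Poitou–Tate
type (below); nothing is booked; no label / mark / count / sub-cell moves; (C1_η), (C2_η-GZ), (C3_η)
stay typed as filed (cc-typer-6's pen); O10 stays OPEN / CONSTRUCTION-SHAPED; nothing about
`BSD(W, p)` of any pair is claimed.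

## What

`W` is the `(−1)^{p/2}p`-twist of a globally minimal `V/ℚ` good at the odd prime `p` with
`a_p(V) = 0`, `W`'s equation `p`-integral, `κ` the cyclotomic `ℤ_p`-extension with topological
generator `γ`, `D` ANY strict-minus dual datum of `Sel^{−,str}(W/ℚ_∞)` (model `ℚ_[p]`),
`A₀ = Sel^{loc,∞}(W/ℚ)`, and `P ∈ W(ℚ)` a point whose image in `W(ℚ_p)` has exact level `ν`.

* `finite_localPreimage_of_mordellWeil_cofinal` — **`A₀` is FINITE** provided (hMW) every class of
  `A₀` has a bounded `p`-power multiple on the Kummer line of `P`: `∃ t, ∀ y ∈ A₀, ∃ m ≥ ν, ∃ a ∈ ℤ,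
  p^t·y = a·Φ_m(κ_m(P))` (`κ_m` the Kummer map at level `p^m`, `Φ_m : H¹(ℚ, W[p^m]) → H¹(ℚ, W[p^∞])`).
  Proof: such a multiple `a·Φ_m(κ_m(P))` lies in `A₀`, so `p^{m−ν} ∣ a` and `p^ν` kills it
  (file 112; `p^m` kills `H¹(ℚ, W[p^m])`); hence `p^{t+ν} · A₀ = 0` and `A₀` is finite (file 113).
* `isTorsion_and_constantCoeff_ne_zero_of_mordellWeil_cofinal` — hence (file 110) **`X^{−,str}(W/ℚ_∞)`
  is finitely generated `Λ`-TORSION and every generator `f` of its characteristic ideal has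
  `ord_T f = 0`, `f(0) ≠ 0`**: the inputs `[Module.Finite]`, `hX`, `h0` of the (C3_η) Selmer side
  (file 108) DISCHARGED modulo (hMW).
(hMW) is where global duality enters: in rank one it says `A₀ ⊆ Sel^{(p)}(W/ℚ)` (relaxed at `p`) is,
up to bounded exponent, the Kummer line of the generator modulo `Ш[p^∞]` — the relaxed-versus-Selmer
finiteness (JSW17 Prop. 3.3.2 shape, from `poitouTate_selmerStructure_duality_real ℚ`, `#Sel_str < ∞`
and the finiteness of `Ш(W)[p^∞]` / of `W(ℚ)_tors`). NOT proved here; NOT a named fact (displayed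
hypothesis). NOT claimed: (C1_η), (C2_η-GZ), (C3_η) as typed; any `BSD(W, p)`.

References: [GreenbergLNM1716] §1 Thm. 1.4 / p. 61, §3 Lemma 3.1–3.2, §4 Lemma 4.2 (p. 102);
[Kobayashi2003] Thm. 2.2 (p. 5), Thm. 6.2 (p. 11), Prop. 8.7 (p. 16), §9; [JetchevSkinnerWan2017]
Prop. 3.3.2 (shape of (hMW) only); [SilvermanAEC2009] VIII.§2.
-/

noncomputable section

open scoped Classical

open CategoryTheory Field Function NumberField IsDedekindDomain WeierstrassCurve
open Literature.NumberTheory.EllipticCurves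
open Literature.NumberTheory.GaloisRepresentations
open Literature.NumberTheory.GaloisCohomology
open Literature.NumberTheory.EllipticCurves.Kobayashi2003
open Literature.NumberTheory.EllipticCurves.IwasawaAlgebra Literature.NumberTheory.EllipticCurves.IwasawaDual
open Summit.BirchSwinnertonDyer.Rank1Residual.X11b.Levels
open Summit.BirchSwinnertonDyer.Rank1Residual.X11b
open scoped ContRepresentation

namespace Summit.BirchSwinnertonDyer.Rank1Residual.Additive.LevelBridge

section Twist

variable (W : WeierstrassCurve ℚ) [W.IsElliptic] {p : ℕ} [hp : Fact p.Prime] (κ : ZpExtension ℚ p)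
  [hint : (W.baseChange ℚ_[p]).IsIntegral ℤ_[p]]

/-- **`A₀ = Sel^{loc,∞}(W/ℚ)` is FINITE in rank one, modulo (hMW).** `W` the `p*`-twist of a globally
minimal good `a_p = 0` curve `V` (`p` odd, `p`-integral equation), `κ` cyclotomic with topological
generator `γ`, `P ∈ W(ℚ)` of exact level `ν` at `p`; (hMW): for some `t`, every `y ∈ A₀` has
`p^t·y = a·Φ_m(κ_m(P))` for some `m ≥ ν`, `a ∈ ℤ`. Then `p^{t+ν}·A₀ = 0` (file 112: `p^{m−ν} ∣ a`,
so `p^ν` kills the multiple), so `A₀` is finite (file 113). [cite: GreenbergLNM1716, §3 Lemma 3.1–3.2 (p. 86)]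
[cite: Kobayashi2003, Thm. 6.2 (p. 11), Prop. 8.7 (p. 16), Lemma 9.1 (p. 25), §9] -/
theorem finite_localPreimage_of_mordellWeil_cofinal
    (hp2 : p ≠ 2) (hκ : κ.IsCyclotomic) (Cv : VariableChange ℚ) (V : WeierstrassCurve ℚ)
    [V.IsElliptic] [V.IsGloballyMinimal] (hCV : Cv • W.quadraticTwist ((-1) ^ (p / 2) * p) = V)
    (hgood : V.HasGoodReductionAtPrime p) (hap : V.frobeniusTrace p = 0)
    {γ : absoluteGaloisGroup ℚ} (hγ : κ.IsTopGenerator γ)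
    {ν : ℕ} (P : W.toAffine.Point) {Q : (W.baseChange ℚ_[p]).toAffine.Point}
    (hPQ : p ^ ν • Q = Affine.Point.baseChange (W' := W) ℚ ℚ_[p] P)
    (hexact : ∀ Q' : (W.baseChange ℚ_[p]).toAffine.Point,
      p ^ (ν + 1) • Q' ≠ Affine.Point.baseChange (W' := W) ℚ ℚ_[p] P)
    -- (hMW): the Poitou–Tate-type input, displayed
    {t : ℕ}
    (hMW : ∀ y ∈ (W.selmerInfty κ ⊓ ⨅ σ : absoluteGaloisGroup ℚ,
        (localKummerOverOfEmb W p κ.kerSubgroup (closureEmb (K := ℚ) ℚ_[p])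
          (⨆ n, strictSignedLocalPoints κ ℚ_[p] W (-1) n)).comap
            (W.conjH1 p κ.kerSubgroup σ)).comap (W.layerToInfty κ 0),
      ∃ (m : ℕ) (_ : ν ≤ m) (a : ℤ), p ^ t • y =
        a • resH1Hom (Literature.NumberTheory.EllipticCurves.subgroupIncl (κ.layerSubgroup 0))
          (AddMonoidHom.id (geomPrimaryTorsion W p)) (fun _ _ ↦ rfl)
          (galoisCohomology.map (primaryInclusion W p m) 1
            (kummerMapTorsion W ((p ^ m : ℕ) : ℤ)
              (W.zsmul_geomPoints_surjective_holds
                (show (((p ^ m : ℕ) : ℤ)) ≠ 0 by exact_mod_cast pow_ne_zero m hp.out.ne_zero)) P))) :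
    Finite ↥((W.selmerInfty κ ⊓ ⨅ σ : absoluteGaloisGroup ℚ,
        (localKummerOverOfEmb W p κ.kerSubgroup (closureEmb (K := ℚ) ℚ_[p])
          (⨆ n, strictSignedLocalPoints κ ℚ_[p] W (-1) n)).comap
            (W.conjH1 p κ.kerSubgroup σ)).comap (W.layerToInfty κ 0)) := by
  refine StrictSignedControlZero.finite_localPreimage_of_pow_smul_eq_zero_of_quadraticTwist_signedPrime κ W
    (-1) hp2 Cv V hCV hgood hap hγ (e := t + ν) fun y hy ↦ ?_
  obtain ⟨m, hm, a, hya⟩ := hMW y hy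
  have hn0 : (((p ^ m : ℕ) : ℤ)) ≠ 0 := by exact_mod_cast pow_ne_zero m hp.out.ne_zero
  set hdiv : ∀ X : geomPoints W, ∃ Y : geomPoints W, ((p ^ m : ℕ) : ℤ) • Y = X :=
    W.zsmul_geomPoints_surjective_holds hn0 with hdiv_def
  -- the multiple lies in `A₀`, so `p^ν` kills it (file 112)
  have hmem : a • resH1Hom (Literature.NumberTheory.EllipticCurves.subgroupIncl (κ.layerSubgroup 0))
      (AddMonoidHom.id (geomPrimaryTorsion W p)) (fun _ _ ↦ rfl)
      (galoisCohomology.map (primaryInclusion W p m) 1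
        (kummerMapTorsion W ((p ^ m : ℕ) : ℤ) hdiv P)) ∈
      (W.selmerInfty κ ⊓ ⨅ σ : absoluteGaloisGroup ℚ,
        (localKummerOverOfEmb W p κ.kerSubgroup (closureEmb (K := ℚ) ℚ_[p])
          (⨆ n, strictSignedLocalPoints κ ℚ_[p] W (-1) n)).comap
            (W.conjH1 p κ.kerSubgroup σ)).comap (W.layerToInfty κ 0) := by
    rw [← hya]; exact AddSubgroup.nsmul_mem _ hy _
  have hkill := pow_smul_zsmul_kummerMapTorsion_eq_zero_of_mem_localPreimage W κ hp2 hκ Cv V hCV hgood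
    hap hdiv hm P hPQ hexact a hmem
  rw [pow_add, mul_nsmul, hya, hkill]

/-- **`X^{−,str}(W/ℚ_∞)` IS FINITELY GENERATED `Λ`-TORSION WITH `f(0) ≠ 0` IN RANK ONE, MODULO
(hMW)** — for EVERY strict-minus dual datum `D` of `Sel^{−,str}(W/ℚ_∞)` (model `ℚ_[p]`): the previous
theorem with file 110 (`A₀` finite ⟹ `X` torsion, `ord_T f = 0`, `f(0) ≠ 0` for every characteristic
generator; `X` finitely generated unconditionally). On the Selmer side of the (C3_η) derivation
(file 108: `#Ш(W)[p^∞]·p^{2ν}·Tam^{(p)} = p^{ord_p f(0)}`) the dual-datum inputs `[Module.Finite]`,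
`hX`, `h0` are therefore DISCHARGED modulo (hMW); `hnf` (Kitajima–Otsuki read on `D`) and the named
fact `hPT` remain. Nothing booked. [cite: GreenbergLNM1716, §1 Thm. 1.4 (p. 60), §4 Lemma 4.2 (p. 102)]
[cite: Kobayashi2003, Thm. 2.2 (p. 5), Thm. 6.2 (p. 11), Thm. 9.3 (p. 26)] -/
theorem isTorsion_and_constantCoeff_ne_zero_of_mordellWeil_cofinal
    (hp2 : p ≠ 2) (hκ : κ.IsCyclotomic) (Cv : VariableChange ℚ) (V : WeierstrassCurve ℚ)
    [V.IsElliptic] [V.IsGloballyMinimal] (hCV : Cv • W.quadraticTwist ((-1) ^ (p / 2) * p) = V)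
    (hgood : V.HasGoodReductionAtPrime p) (hap : V.frobeniusTrace p = 0)
    {γ : absoluteGaloisGroup ℚ} (hγ : κ.IsTopGenerator γ) (D : StrictSignedSelmerDualData W κ ℚ_[p] γ (-1))
    {ν : ℕ} (P : W.toAffine.Point) {Q : (W.baseChange ℚ_[p]).toAffine.Point}
    (hPQ : p ^ ν • Q = Affine.Point.baseChange (W' := W) ℚ ℚ_[p] P)
    (hexact : ∀ Q' : (W.baseChange ℚ_[p]).toAffine.Point,
      p ^ (ν + 1) • Q' ≠ Affine.Point.baseChange (W' := W) ℚ ℚ_[p] P)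
    {t : ℕ}
    (hMW : ∀ y ∈ (W.selmerInfty κ ⊓ ⨅ σ : absoluteGaloisGroup ℚ,
        (localKummerOverOfEmb W p κ.kerSubgroup (closureEmb (K := ℚ) ℚ_[p])
          (⨆ n, strictSignedLocalPoints κ ℚ_[p] W (-1) n)).comap
            (W.conjH1 p κ.kerSubgroup σ)).comap (W.layerToInfty κ 0),
      ∃ (m : ℕ) (_ : ν ≤ m) (a : ℤ), p ^ t • y =
        a • resH1Hom (Literature.NumberTheory.EllipticCurves.subgroupIncl (κ.layerSubgroup 0))
          (AddMonoidHom.id (geomPrimaryTorsion W p)) (fun _ _ ↦ rfl)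
          (galoisCohomology.map (primaryInclusion W p m) 1
            (kummerMapTorsion W ((p ^ m : ℕ) : ℤ)
              (W.zsmul_geomPoints_surjective_holds
                (show (((p ^ m : ℕ) : ℤ)) ≠ 0 by exact_mod_cast pow_ne_zero m hp.out.ne_zero)) P))) :
    Module.Finite (IwasawaAlgebra p) D.X ∧ Module.IsTorsion (IwasawaAlgebra p) D.X ∧
      ∀ f : IwasawaAlgebra p, D.charIdeal = Ideal.span {f} →
        f.order = 0 ∧ PowerSeries.constantCoeff f ≠ 0 :=
  StrictSignedControlZero.moduleFinite_isTorsion_constantCoeff_ne_zero_of_finite_localPreimage_of_quadraticTwist_signedPrime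
    κ W (-1) hp2 Cv V hCV hgood hap hγ D
    (finite_localPreimage_of_mordellWeil_cofinal W κ hp2 hκ Cv V hCV hgood hap hγ P hPQ hexact hMW)

end Twist

end Summit.BirchSwinnertonDyer.Rank1Residual.Additive.LevelBridge

end
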